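/-
Copyright: statement-level skeleton of a published paper (lit-balaban cell, Phase-2 proof seat p26 gen 40). No claims beyond
what the kernel checks below.
-/
import Mathlib
import Literature.MathematicalPhysics.QuantumFieldTheory.Balaban1983to89.B3Cor23Concrete

/-!
# B3 — T. Bałaban, *(Higgs)₂,₃ quantum fields in a finite volume. III. Renormalization*, CMP **88** (1983) 411–445
[Balaban1983Higgs3] — pp. 414–415, 419–420, 424–425 [PDF 4–5, 9–10, 14–15]: **the expression E(G, ·) corresponding to a graph G
of the perturbation expansion — a Feynman-rule EVALUATOR `amp` on p18's concrete graph model `B3Cor23Concrete.Graph`**, in index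
form (every pair of contracted legs *"replaced by the corresponding propagator"*), with the scale decomposition **(2.7)** and the
localization sum of p. 420 PROVED on it (FILE 1 of the evaluator: the vertex rules of the catalogue (1.6)–(1.15) enter as supplied
parameters)

statement-level skeleton of published theorems with citation tags; proofs where landed; nothing here is a claim about
the Yang–Mills mass gap

PDF held: `paper:balaban1983-higgs-2-3-quantum-fields-finite-volume` (journal page = PDF page + 410); pp. 414, 415, 419, 420, 424, 425
read by this seat on the ×2 renders `run/shared/lean/pub/pub-balaban/b2b-balaban-ref1/pages/1983-cmp88-higgs23-III/…-p004,p005,p010,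
p014,p015-x2.png` (2026-08-23).

CITATION HEADER (lean-in-tree rule).  lit-balaban TYPED SKELETON (HOME `run/shared/lean/pub/lit-balaban/`), PHASE 2, seat p26 gen 40
(unit `lit-balaban-p26`; TAKING #2, HOME/STATUS.md 2026-08-23T09:59Z); OWNER-NAMED target: the fold owner r15 g15's HEAD QUESTION 26 on
row **B3.Def@420** (HOME/INBOX 2026-08-23T09:39Z, reading (T′): *"a Feynman-rule evaluator `Graph.amp` on p18's `B3Cor23Concrete.Graph`"*;
reading (P′): *"identification with `B3Prop1.Expansion.E` owed at B3.Prop1"*) and the owner's word to this seat 2026-08-23T09:56Z *"WELCOME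
EITHER WAY — please TAKE it … keep the amplitude's INPUT kernels … as supplied kernel parameters"*; design note
`HOME/lit-balaban-p26/DESIGN-B3-evaluator.md`.  ROWS **B3.Def@420** (p. 420 E(G, {□(v)}, Φ_ext, A_ext)), **B3.Eq2.7** ((2.7) p. 425,
`proved-existing`) of `HOME/lit-balaban-r15/ROWS-B3.md` (fold owner r15; cells only, heads are the owner's / the lead's call).  CONSUMES BY
NAME: p18's model `B3Cor23Concrete.Graph` (vertices `kind`, legs `Leg`, lines `other`, `other_symm`, `other_ne`, `other_isLeft`;
p239034 lineage) and r15's catalogue data `B3Prop1.VertexKind.scalarLegs/vectorLegs`.  Companion: this seat's `B3LocalizedExpression420`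
(p360031: localization of ONE position sum; here the same mechanism for whole graphs, `amp_rules_sum`).

THE PRINTED TEXT (verbatim).  p. 414 [PDF 4], lines 36–46 of the page (×2 render p004; v1.1: the v1.0 header paraphrased this
passage — referee ref-4 D-g68-2): *"Now we can describe an arbitrary expression in the expansion. It consists of a number of vertices.
The maximal number of vertices depends in a simple way on n̄, but it is unessential here. All the A′-legs are contracted, i.e. they are
divided into pairs and each pair is replaced by the corresponding propagator. Some φ′-legs are replaced by external scalar fields and
the remaining are again divided into pairs and each pair is replaced by a propagator, i.e. by G_k(Ω,B̃), G_k(Ω₂,B̃), δG_k(Ω,Ω₂,B̃) or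
the operator (1.16). Of course the whole expression is multiplied by a proper combinatorial factor connected with the number of ways
given expression can be obtained from Gaussian integrals in (1.5)."*; p. 415 [PDF 5]: *"Now a graph for us is a collection of
internal lines, external legs, and vertices … every internal line has a vertex at each endpoint."*; p. 419 [PDF 9]: *"we will consider
external fields in the form of functions Φ_ext(x, x′, x″, …), A_ext(y, y′, y″, …) of many variables instead of a product."*; p. 420
[PDF 10]: *"Let us denote by E(G, {□(v)}_{v∈G}, Φ_ext, A_ext) the expression corresponding to graph G with localizations {□(v)}_{v∈G}
and external fields Φ_ext, A_ext."*; pp. 424–425 [PDF 14–15]: *"Our first step in the proof of the theorem is to write the expression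
E(G, {□(v)}_{v∈G}, Φ_ext, A_ext) = E(G′, {□(v)}_{v∈G}, Φ′_ext, A_ext) as a sum obtained by decomposing all the propagators corresponding
to the lines of G′ according to the equality [(2.6)] and the similar equality for the vector field propagator. Thus we get a sum of
new expressions obtained by replacing in each line l of the graph G′ the corresponding propagator by a propagator G^η_{(j_l)},
0 ≦ j_l ≦ k − 1. Let us add index j_l to the line and let us denote by G′(j) the graph G′ with indices added, j = {j_l}_{l∈G′}. We can
write E(G′) as a sum Σ_j E(G′(j))."*

READING (declared; print never displays general Feynman rules — this is OUR typing of *"the expression corresponding to graph G"*).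
A VERTEX of the catalogue is a POLARIZED multilinear functional of one field per leg — one `W`-valued lattice field per φ′-leg (in
coordinates: `X → Fin N → ℝ`, `X` = sites, `Fin N` = an orthonormal basis of the internal space W = ℝ^N) and one real bond field per
A′-leg (`Bd → ℝ`) — with its position sum, its localization weight, its couplings, the external vector field Ã, the background B̃ and
the cut-off g_k INSIDE it (as in the printed vertices (1.6)–(1.11), which carry Σ_{x∈Ω₁} / Σ_b); these RULES `V i` are supplied per
vertex (`Rules`; the polarized forms of the catalogue and their identification with the typer's `vertex16 … vertex115` are FILE 2 of
the design note).  Contraction *"each pair is replaced by the corresponding propagator"* in INDEX FORM: every φ′-leg ℓ receives an index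
`α ℓ = (x, a) ∈ X × Fin N`, every A′-leg an index `β ℓ ∈ Bd`; the vertex rules are evaluated on the corresponding basis fields
(`basisS`, `basisV`); every internal LINE contributes the matrix entry of its propagator between the indices of its two legs (scalar:
`Ks l (x,a) (x′,b) = ⟪e_a, G_k(Ω,B̃)(x,x′)e_b⟫`, supplied PER LINE so that the scale-decomposed graphs G′(j) of (2.7) are instances;
vector: `Kv l b b′`); the EXTERNAL legs contribute the component function of the external fields, jointly in all external legs (p. 419's
*"functions of many variables"*; product fields = `prodExtS`/`prodExtV`); the averaging vertices (1.13)–(1.15) have moreover one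
`W`-valued OUTPUT slot at their point `y` (`outSlots`, `OLeg`), read against a basis co-vector of index `ο ℓ ∈ Fin N` and paired by
(1.18) p. 415 — with another averaging vertex at the same `y` (a supplied `OutPairing`, NOT part of p18's `Graph`, kernel `Ko` =
`−a_k·δ` at the common point) or, if unpaired, with the external field (1.12) (`Ψ`); everything is summed over `α`, `β`, `ο`:
**E(G) = Σ_α Σ_β Σ_ο (Π_i V_i(basis elements at α, β, ο)) · Φ̂(α|_ext) · Â(β|_ext) · Ψ̂(ο|_unpaired) · Π_{scalar lines} Ks_l(α ℓ, α ℓ′)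
· Π_{vector lines} Kv_l(β ℓ, β ℓ′) · Π_{output pairs} Ko_l(ο ℓ, ο ℓ′)** (`amp`; typed over ABSTRACT leg-field types `SF`, `VF` with supplied basis families `bS : IS → SF`, `bV : IV → VF`
over finite index types — the coordinate instance `IS = X × Fin N`, `IV = Bd`, `basisS`/`basisV` is `ampCoord`; the typer's
`ScalarField`/`VecField` carriers of the catalogue are another instance, FILE 2).  Lines: an internal line {ℓ, ℓ′} of p18's pairing `other` (symmetric, no fixed point) is represented ONCE,
by its endpoint of LOWER rank under the injective leg rank `Nat.pair (vertex, leg)` (`Pairing.isLower`, `Pairing.lower_xor`).  The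
*"proper combinatorial factor"* is the vertex rules' / the class coefficients' business (not modelled here).

WHAT IS TYPED / PROVED (definitions with bodies + theorems; no `Prop` fact, no `sorry`; standard axioms).
§1 `Pairing` (a species of legs with *"the other endpoint"*: `symm`, `ne`), `Pairing.mate`, `Pairing.isLower`, `Pairing.Line`,
`Pairing.isLower_iff`, `Pairing.mate_eq`, **`Pairing.lower_xor`** (each line has exactly one lower endpoint), `Pairing.trichotomy` (every leg is external, a lower endpoint, or the mate of one), `Pairing.not_isLower_of_none`;
§2 on p18's `Graph`: `SLeg`/`VLeg` (the φ′-legs and the A′-legs of the vertex family), `toLeg`, `sRank`/`vRank` + injectivity, `toSLeg?`/`toVLeg?`,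
**`spartner`/`vpartner`** (p18's `other` restricted to each species; `spartner_eq_some_iff`, `spartner_eq_none_iff`, `vpartner_…`),
`sPairing`/`vPairing`, `SLine`/`VLine`, `ExtSLeg`/`ExtVLeg`; §3 `outSlots` (one `W`-valued output for (1.13)–(1.15)), `OLeg`, `oRank`;
§4 `Rules` (over abstract leg-field types `SF`, `VF`, `OF` with supplied bases `bS : IS → SF`, `bV : IV → VF`, `bO : IO → OF` indexed by
finite index types), `OutPairing` (the (1.18) pairing of outputs, supplied), `basisS`/`basisV`/`basisO` (the coordinate bases),
`vertexFactor`, `sLineFactor`/`vLineFactor`/`oLineFactor`, `prodExtS`/`prodExtV`, **`amp`** = E(G, Φ_ext, A_ext) WITH BODY, `ampCoord`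
(the coordinate instance); §5 THEOREMS: **`amp_sLines_sum`** / **`amp_vLines_sum`** = (2.7)
pp. 424–425 ON THE EVALUATOR (*"decomposing all the propagators corresponding to the lines … We can write E(G′) as a sum Σ_j E(G′(j))"*:
`Ks l = Σ_t K l t` for every line ⇒ `amp … = Σ_{j : lines → scales} amp …(K · (j ·))…`; the resummation over orderings l̃ / index
sets J(l̃) of (2.7) is row B3.Eq2.7's `proved-existing` content and is not repeated), **`amp_rules_sum`** = p. 420 *"with each
expression there is connected some localization {□(v)}_{v∈G}"* ON THE EVALUATOR (vertex rules that are sums over their localizations,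
`V i = Σ_{c∈C i} W i c`, give `amp G V = Σ_{c : Π_i C i} amp G (W · (c ·))` — E(G) = Σ_{{□(v)}} E(G, {□(v)}), the whole-graph form of
`B3LocalizedExpression420.sum_locSum_eq`), `amp_add_extS` / `amp_smul_extS` (E is linear in the external scalar field).
HONEST SCOPE.  (a) FILE 1 fixes the SHAPE of E(G, ·): the catalogue's polarized rules, the identification of their diagonals with
the typer's vertices, the consistency with the per-picture dictionaries (`B3Eq37Pictures.LocPicture.amp`, (3.9)'s `sigma39`) and
the (2.13) majorant bridge to p19's `B3Ineq213Amplitude.Amp.E` are the successor files named in the design note; nothing of them is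
claimed here.  (b) Input kernels (G_k(Ω,B̃), G_k, the (1.13)–(1.15) operator legs) are PARAMETERS (`Ks`, `Kv`, inside `V`), per the
owner's precision; the tree's names (`HiggsCovariance.propagatorK`, the typer's `vertex113 … vertex115`) enter at instantiation.
(c) The carriers are arbitrary finite types; no lattice geometry is used in FILE 1.  (d) The (1.18) pairing of the outputs of the averaging
vertices (1.13)–(1.15) (which of them are multiplied in pairs at a common `y`, which are multiplied with the external field (1.12))
is NOT recorded by p18's `Graph` (`other` pairs φ′-legs and A′-legs only): it is a supplied datum `OutPairing` of the evaluator,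
with its kernels `Ko` and external components `Ψ`; that the two members of a pair sit at the same point `y` and carry print's
coefficient `−a_k` / `−½a_k` is the business of `Ko`, `Ψ` and the rules (FILE 2).  Unit `lit-balaban-p26` gen 40
(literature-prover-lit-balaban-p26-g40-0), HOME `run/shared/lean/pub/lit-balaban/`, 2026-08-23.
-/

open Finset
open scoped BigOperators

namespace Literature.MathematicalPhysics.QuantumFieldTheory.Balaban1983to89.B3GraphAmplitude

open B3Prop1 B3Cor23Concrete

/-! ## §1 Pairings of one species of legs: the other endpoint, lines as lower endpoints -/

/-- A PAIRING of a species of legs (p. 415: *"every internal line has a vertex at each endpoint"*; p18's `Graph.other` restricted to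
the φ′-legs, resp. to the A′-legs — p. 414: scalar legs pair with scalar legs, vector legs with vector legs): `other x` = the other
endpoint of the line through `x` (`none` = `x` is external), symmetric and without fixed points. [cite: Balaban1983Higgs3, p.415] -/
structure Pairing (L : Type*) where
  /-- the other endpoint of the line through a leg (`none`: the leg is external) -/
  other : L → Option L
  /-- "the other endpoint" is symmetric -/
  symm : ∀ x y, other x = some y → other y = some x
  /-- a line has two distinct endpoints -/
  ne : ∀ x y, other x = some y → y ≠ x

namespace Pairing

variable {L : Type*} (Pr : Pairing L) (rank : L → ℕ)

/-- The mate of a leg: the other endpoint of its line (itself if external). [cite: Balaban1983Higgs3, p.415] -/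
def mate (x : L) : L := (Pr.other x).getD x

/-- A leg is the LOWER endpoint of its line (for a rank function on legs): internal, and of smaller rank than its mate — the lines of
the graph are represented by their lower endpoints, each exactly once (`lower_xor`). [cite: Balaban1983Higgs3, p.415] -/
def isLower (x : L) : Bool :=
  match Pr.other x with
  | some y => decide (rank x < rank y)
  | none => false

/-- The internal lines of the species, as the legs that are lower endpoints. [cite: Balaban1983Higgs3, p.415] -/
abbrev Line : Type _ := {x : L // Pr.isLower rank x = true}

/-- The external legs of the species (`other = none`). [cite: Balaban1983Higgs3, p.415] -/
abbrev Ext : Type _ := {x : L // Pr.other x = none}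

/-- unfolding `isLower`. [cite: Balaban1983Higgs3, p.415] -/
theorem isLower_iff (x : L) : Pr.isLower rank x = true ↔ ∃ y, Pr.other x = some y ∧ rank x < rank y := by
  unfold isLower
  cases h : Pr.other x with
  | none => simp
  | some y => simp

/-- an external leg is not a lower endpoint. [cite: Balaban1983Higgs3, p.415] -/
theorem not_isLower_of_none {x : L} (h : Pr.other x = none) : Pr.isLower rank x = false := by
  unfold isLower
  rw [h]

/-- the mate of an internal leg is the other endpoint. [cite: Balaban1983Higgs3, p.415] -/
theorem mate_eq {x y : L} (h : Pr.other x = some y) : Pr.mate x = y := by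
  simp [mate, h]

/-- the mate of an external leg is the leg itself. [cite: Balaban1983Higgs3, p.415] -/
theorem mate_eq_self {x : L} (h : Pr.other x = none) : Pr.mate x = x := by
  simp [mate, h]

/-- **Each internal line has exactly one lower endpoint** (for an injective rank): of the two endpoints `x`, `y` of a line exactly one
is lower — so a product over `Line` visits every internal line once. [cite: Balaban1983Higgs3, p.415] -/
theorem lower_xor (hr : Function.Injective rank) {x y : L} (h : Pr.other x = some y) :
    (Pr.isLower rank x = true ∧ Pr.isLower rank y = false) ∨ (Pr.isLower rank x = false ∧ Pr.isLower rank y = true) := by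
  have h' : Pr.other y = some x := Pr.symm x y h
  have hne : rank x ≠ rank y := fun e => Pr.ne x y h (hr e).symm
  have ex : Pr.isLower rank x = decide (rank x < rank y) := by unfold isLower; rw [h]
  have ey : Pr.isLower rank y = decide (rank y < rank x) := by unfold isLower; rw [h']
  rw [ex, ey]
  rcases lt_or_gt_of_ne hne with hlt | hgt
  · left
    exact ⟨decide_eq_true hlt, decide_eq_false (not_lt.mpr hlt.le)⟩
  · right
    exact ⟨decide_eq_false (not_lt.mpr hgt.le), decide_eq_true hgt⟩

/-- the mate of a lower endpoint is internal, with the lower endpoint as its mate. [cite: Balaban1983Higgs3, p.415] -/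
theorem other_mate_of_isLower {x : L} (h : Pr.isLower rank x = true) : Pr.other (Pr.mate x) = some x := by
  obtain ⟨y, hy, -⟩ := (Pr.isLower_iff rank x).1 h
  rw [Pr.mate_eq hy]
  exact Pr.symm x y hy

/-- **Every leg is exactly one of: external, the lower endpoint of its line, the mate of the lower endpoint of its line** — so the
factors of the evaluator below (external-field components at the external legs, one kernel per lower endpoint paired with its mate)
visit every leg of the species exactly once. [cite: Balaban1983Higgs3, p.415] -/
theorem trichotomy (hr : Function.Injective rank) (x : L) :
    Pr.other x = none ∨ Pr.isLower rank x = true ∨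
      (Pr.isLower rank x = false ∧ Pr.isLower rank (Pr.mate x) = true ∧ Pr.mate (Pr.mate x) = x) := by
  cases h : Pr.other x with
  | none => exact Or.inl rfl
  | some y =>
    right
    rcases Pr.lower_xor rank hr h with ⟨hx, -⟩ | ⟨hx, hy⟩
    · exact Or.inl hx
    · right
      refine ⟨hx, ?_, ?_⟩
      · rw [Pr.mate_eq h]
        exact hy
      · rw [Pr.mate_eq h, Pr.mate_eq (Pr.symm x y h)]

end Pairing

/-! ## §2 The two species of legs of p18's graphs, their partners and lines -/

section Legs

variable {nV : ℕ}

/-- The φ′-legs of a family of catalogue vertices: a vertex `i` with one of its `scalarLegs` slots (p18's `Leg kind`, left summand).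
[cite: Balaban1983Higgs3, (1.17) p.415] -/
abbrev SLeg (kind : Fin nV → VertexKind) : Type := Σ i : Fin nV, Fin (kind i).scalarLegs

/-- The A′-legs of a family of catalogue vertices (p18's `Leg kind`, right summand). [cite: Balaban1983Higgs3, (1.17) p.415] -/
abbrev VLeg (kind : Fin nV → VertexKind) : Type := Σ i : Fin nV, Fin (kind i).vectorLegs

variable {kind : Fin nV → VertexKind}

/-- a φ′-leg as a leg of p18's model. [cite: Balaban1983Higgs3, (1.17) p.415] -/
def SLeg.toLeg (ℓ : SLeg kind) : Leg kind := ⟨ℓ.1, Sum.inl ℓ.2⟩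

/-- an A′-leg as a leg of p18's model. [cite: Balaban1983Higgs3, (1.17) p.415] -/
def VLeg.toLeg (ℓ : VLeg kind) : Leg kind := ⟨ℓ.1, Sum.inr ℓ.2⟩

/-- The rank of a φ′-leg: the Cantor pairing of (vertex, slot) — injective, used only to orient the lines. [cite: Balaban1983Higgs3, p.415] -/
def sRank (ℓ : SLeg kind) : ℕ := Nat.pair ℓ.1.val ℓ.2.val

/-- The rank of an A′-leg. [cite: Balaban1983Higgs3, p.415] -/
def vRank (ℓ : VLeg kind) : ℕ := Nat.pair ℓ.1.val ℓ.2.val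

/-- the φ′-leg rank is injective. [cite: Balaban1983Higgs3, p.415] -/
theorem sRank_injective : Function.Injective (sRank (kind := kind)) := by
  rintro ⟨i, j⟩ ⟨i', j'⟩ h
  simp only [sRank, Nat.pair_eq_pair] at h
  obtain ⟨h1, h2⟩ := h
  obtain rfl : i = i' := Fin.ext h1
  obtain rfl : j = j' := Fin.ext h2
  rfl

/-- the A′-leg rank is injective. [cite: Balaban1983Higgs3, p.415] -/
theorem vRank_injective : Function.Injective (vRank (kind := kind)) := by
  rintro ⟨i, j⟩ ⟨i', j'⟩ h
  simp only [vRank, Nat.pair_eq_pair] at h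
  obtain ⟨h1, h2⟩ := h
  obtain rfl : i = i' := Fin.ext h1
  obtain rfl : j = j' := Fin.ext h2
  rfl

/-- a leg of p18's model read as a φ′-leg (`none` for A′-legs). [cite: Balaban1983Higgs3, (1.17) p.415] -/
def toSLeg? : Option (Leg kind) → Option (SLeg kind)
  | some ⟨i, Sum.inl j⟩ => some ⟨i, j⟩
  | some ⟨_, Sum.inr _⟩ => none
  | none => none

/-- a leg of p18's model read as an A′-leg (`none` for φ′-legs). [cite: Balaban1983Higgs3, (1.17) p.415] -/
def toVLeg? : Option (Leg kind) → Option (VLeg kind)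
  | some ⟨i, Sum.inr j⟩ => some ⟨i, j⟩
  | some ⟨_, Sum.inl _⟩ => none
  | none => none

/-- `toSLeg?` recognises exactly the φ′-legs. [cite: Balaban1983Higgs3, (1.17) p.415] -/
theorem toSLeg?_eq_some_iff (o : Option (Leg kind)) (ℓ : SLeg kind) : toSLeg? o = some ℓ ↔ o = some ℓ.toLeg := by
  obtain ⟨i', j'⟩ := ℓ
  rcases o with _ | ⟨i, j | j⟩
  · simp [toSLeg?]
  · simp only [toSLeg?, SLeg.toLeg, Option.some.injEq]
    constructor
    · intro h
      cases h
      rfl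
    · intro h
      simp only [Sigma.mk.injEq] at h
      obtain ⟨rfl, hj⟩ := h
      obtain rfl := (Sum.inl.injEq _ _).mp (eq_of_heq hj) |> id
      rfl
  · simp only [toSLeg?, SLeg.toLeg, reduceCtorEq, Option.some.injEq, Sigma.mk.injEq, false_iff, not_and]
    intro h hj
    subst h
    exact Sum.inr_ne_inl (eq_of_heq hj)

/-- `toVLeg?` recognises exactly the A′-legs. [cite: Balaban1983Higgs3, (1.17) p.415] -/
theorem toVLeg?_eq_some_iff (o : Option (Leg kind)) (ℓ : VLeg kind) : toVLeg? o = some ℓ ↔ o = some ℓ.toLeg := by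
  obtain ⟨i', j'⟩ := ℓ
  rcases o with _ | ⟨i, j | j⟩
  · simp [toVLeg?]
  · simp only [toVLeg?, VLeg.toLeg, reduceCtorEq, Option.some.injEq, Sigma.mk.injEq, false_iff, not_and]
    intro h hj
    subst h
    exact Sum.inl_ne_inr (eq_of_heq hj)
  · simp only [toVLeg?, VLeg.toLeg, Option.some.injEq]
    constructor
    · intro h
      cases h
      rfl
    · intro h
      simp only [Sigma.mk.injEq] at h
      obtain ⟨rfl, hj⟩ := h
      obtain rfl := (Sum.inr.injEq _ _).mp (eq_of_heq hj) |> id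
      rfl

/-- `toSLeg?` is `none` exactly off the φ′-legs. [cite: Balaban1983Higgs3, (1.17) p.415] -/
theorem toSLeg?_eq_none_iff (o : Option (Leg kind)) : toSLeg? o = none ↔ ∀ ℓ : SLeg kind, o ≠ some ℓ.toLeg := by
  constructor
  · intro h ℓ ho
    have := (toSLeg?_eq_some_iff o ℓ).2 ho
    rw [h] at this
    cases this
  · intro h
    cases ho : toSLeg? o with
    | none => rfl
    | some ℓ => exact absurd ((toSLeg?_eq_some_iff o ℓ).1 ho) (h ℓ)

/-- `toVLeg?` is `none` exactly off the A′-legs. [cite: Balaban1983Higgs3, (1.17) p.415] -/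
theorem toVLeg?_eq_none_iff (o : Option (Leg kind)) : toVLeg? o = none ↔ ∀ ℓ : VLeg kind, o ≠ some ℓ.toLeg := by
  constructor
  · intro h ℓ ho
    have := (toVLeg?_eq_some_iff o ℓ).2 ho
    rw [h] at this
    cases this
  · intro h
    cases ho : toVLeg? o with
    | none => rfl
    | some ℓ => exact absurd ((toVLeg?_eq_some_iff o ℓ).1 ho) (h ℓ)

end Legs

section GraphLines

variable {nbar : ℕ} (G : Graph nbar)

/-- **The partner of a φ′-leg** in the graph: the φ′-leg at the other end of its scalar line (`none`: the leg is external — an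
external scalar field sits in it). [cite: Balaban1983Higgs3, p.415] -/
def spartner (ℓ : SLeg G.kind) : Option (SLeg G.kind) := toSLeg? (G.other ℓ.toLeg)

/-- **The partner of an A′-leg**: the A′-leg at the other end of its vector line (`none`: external). [cite: Balaban1983Higgs3, p.415] -/
def vpartner (ℓ : VLeg G.kind) : Option (VLeg G.kind) := toVLeg? (G.other ℓ.toLeg)

/-- `spartner` is p18's `other` on φ′-legs. [cite: Balaban1983Higgs3, p.415] -/
theorem spartner_eq_some_iff (ℓ ℓ' : SLeg G.kind) : spartner G ℓ = some ℓ' ↔ G.other ℓ.toLeg = some ℓ'.toLeg :=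
  toSLeg?_eq_some_iff _ _

/-- `vpartner` is p18's `other` on A′-legs. [cite: Balaban1983Higgs3, p.415] -/
theorem vpartner_eq_some_iff (ℓ ℓ' : VLeg G.kind) : vpartner G ℓ = some ℓ' ↔ G.other ℓ.toLeg = some ℓ'.toLeg :=
  toVLeg?_eq_some_iff _ _

/-- A φ′-leg without partner is an EXTERNAL leg of p18's model (scalar lines join φ′-legs only, `other_isLeft`).
[cite: Balaban1983Higgs3, p.415] -/
theorem spartner_eq_none_iff (ℓ : SLeg G.kind) : spartner G ℓ = none ↔ G.other ℓ.toLeg = none := by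
  unfold spartner
  rw [toSLeg?_eq_none_iff]
  constructor
  · intro h
    cases hy : G.other ℓ.toLeg with
    | none => rfl
    | some y =>
      obtain ⟨i', j', rfl, -⟩ := G.other_scalar (i := ℓ.1) (j := ℓ.2) hy
      exact absurd hy (h ⟨i', j'⟩)
  · intro h ℓ' hℓ'
    rw [h] at hℓ'
    cases hℓ'

/-- An A′-leg without partner is an external leg of p18's model. [cite: Balaban1983Higgs3, p.415] -/
theorem vpartner_eq_none_iff (ℓ : VLeg G.kind) : vpartner G ℓ = none ↔ G.other ℓ.toLeg = none := by
  unfold vpartner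
  rw [toVLeg?_eq_none_iff]
  constructor
  · intro h
    cases hy : G.other ℓ.toLeg with
    | none => rfl
    | some y =>
      obtain ⟨i', j', rfl, -⟩ := G.other_vector (i := ℓ.1) (j := ℓ.2) hy
      exact absurd hy (h ⟨i', j'⟩)
  · intro h ℓ' hℓ'
    rw [h] at hℓ'
    cases hℓ'

/-- **The scalar lines of the graph as a pairing of its φ′-legs** (symmetric: p18's `other_symm`; no fixed point: `other_ne`).
[cite: Balaban1983Higgs3, p.415] -/
def sPairing : Pairing (SLeg G.kind) where
  other := spartner G
  symm x y h := by
    rw [spartner_eq_some_iff] at h ⊢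
    exact G.other_symm _ _ h
  ne x y h := by
    rw [spartner_eq_some_iff] at h
    intro e
    exact G.other_ne _ _ h (by rw [e])

/-- **The vector lines of the graph as a pairing of its A′-legs.** [cite: Balaban1983Higgs3, p.415] -/
def vPairing : Pairing (VLeg G.kind) where
  other := vpartner G
  symm x y h := by
    rw [vpartner_eq_some_iff] at h ⊢
    exact G.other_symm _ _ h
  ne x y h := by
    rw [vpartner_eq_some_iff] at h
    intro e
    exact G.other_ne _ _ h (by rw [e])

/-- The internal scalar lines of the graph (lower endpoints under `sRank`). [cite: Balaban1983Higgs3, p.415] -/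
abbrev SLine : Type := (sPairing G).Line sRank

/-- The internal vector lines of the graph. [cite: Balaban1983Higgs3, p.415] -/
abbrev VLine : Type := (vPairing G).Line vRank

/-- The external φ′-legs (p. 414: *"Some φ′-legs are replaced by external scalar fields and the remaining are again divided into pairs"*;
v1.2 requote, ref-4 D-g69-1: the earlier gloss «there are scalar fields φ′ in these legs» is not printed). [cite: Balaban1983Higgs3, p.414] -/
abbrev ExtSLeg : Type := (sPairing G).Ext

/-- The external A′-legs. [cite: Balaban1983Higgs3, p.414] -/
abbrev ExtVLeg : Type := (vPairing G).Ext

/-- Every internal scalar line of the graph is represented by exactly one of its two φ′-legs. [cite: Balaban1983Higgs3, p.415] -/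
theorem sLine_xor {ℓ ℓ' : SLeg G.kind} (h : spartner G ℓ = some ℓ') :
    ((sPairing G).isLower sRank ℓ = true ∧ (sPairing G).isLower sRank ℓ' = false) ∨
      ((sPairing G).isLower sRank ℓ = false ∧ (sPairing G).isLower sRank ℓ' = true) :=
  (sPairing G).lower_xor sRank sRank_injective h

/-- Every internal vector line is represented by exactly one of its two A′-legs. [cite: Balaban1983Higgs3, p.415] -/
theorem vLine_xor {ℓ ℓ' : VLeg G.kind} (h : vpartner G ℓ = some ℓ') :
    ((vPairing G).isLower vRank ℓ = true ∧ (vPairing G).isLower vRank ℓ' = false) ∨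
      ((vPairing G).isLower vRank ℓ = false ∧ (vPairing G).isLower vRank ℓ' = true) :=
  (vPairing G).lower_xor vRank vRank_injective h

end GraphLines

/-! ## §3 The output slots of the averaging vertices (1.13)–(1.15) and their pairing (1.18) -/

section Outputs

/-- The number of `W`-valued OUTPUT slots of a vertex: the averaging expressions (1.13)–(1.15) are vectors of the internal space at
their point `y` (to be paired by (1.18) p. 415 with the external field (1.12) or with another averaging expression at the same `y`);
the other vertices are scalars. [cite: Balaban1983Higgs3, (1.18) p.415] -/
def outSlots (κ : VertexKind) : ℕ := if κ.isOfForm1315 then 1 else 0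

/-- (1.13)–(1.15) have one output slot. [cite: Balaban1983Higgs3, (1.18) p.415] -/
theorem outSlots_of_isOfForm1315 {κ : VertexKind} (h : κ.isOfForm1315 = true) : outSlots κ = 1 := by
  simp [outSlots, h]

/-- the other vertices have none. [cite: Balaban1983Higgs3, (1.18) p.415] -/
theorem outSlots_of_not_isOfForm1315 {κ : VertexKind} (h : κ.isOfForm1315 = false) : outSlots κ = 0 := by
  simp [outSlots, h]

variable {nV : ℕ}

/-- The output slots of a family of catalogue vertices (one per vertex of the form (1.13)–(1.15)). [cite: Balaban1983Higgs3, (1.18) p.415] -/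
abbrev OLeg (kind : Fin nV → VertexKind) : Type := Σ i : Fin nV, Fin (outSlots (kind i))

/-- The rank of an output slot. [cite: Balaban1983Higgs3, (1.18) p.415] -/
def oRank {kind : Fin nV → VertexKind} (ℓ : OLeg kind) : ℕ := Nat.pair ℓ.1.val ℓ.2.val

/-- the output-slot rank is injective. [cite: Balaban1983Higgs3, (1.18) p.415] -/
theorem oRank_injective {kind : Fin nV → VertexKind} : Function.Injective (oRank (kind := kind)) := by
  rintro ⟨i, j⟩ ⟨i', j'⟩ h
  simp only [oRank, Nat.pair_eq_pair] at h
  obtain ⟨h1, h2⟩ := h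
  obtain rfl : i = i' := Fin.ext h1
  obtain rfl : j = j' := Fin.ext h2
  rfl

end Outputs

/-! ## §4 The evaluator: E(G, Φ_ext, A_ext) in index form -/

section Amplitude

variable {nbar : ℕ} (G : Graph nbar) (SF VF OF : Type*)

/-- **Feynman rules for the vertices**: for each vertex `i` of the graph a POLARIZED functional of one scalar-leg field per φ′-leg
(type `SF`: a `W`-valued lattice field, e.g. in coordinates `X → Fin N → ℝ`), one vector-leg field per A′-leg (type `VF`, e.g. a bond
field `Bd → ℝ`) and, for the averaging vertices (1.13)–(1.15), one OUTPUT co-vector (type `OF`, e.g. `Fin N → ℝ`) against which the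
vertex's `W`-valued output is read — the printed vertex (1.6)–(1.15) of kind `G.kind i` with its position sum, localization weight,
couplings, Ã, B̃, g_k inside (supplied; FILE 2 of the design note). [cite: Balaban1983Higgs3, (1.6)–(1.15) pp.413–414] -/
abbrev Rules : Type _ :=
  (i : Fin G.nV) → (Fin (G.kind i).scalarLegs → SF) → (Fin (G.kind i).vectorLegs → VF) → (Fin (outSlots (G.kind i)) → OF) → ℝ

/-- **The (1.18) pairing of the outputs of the averaging vertices** — NOT part of p18's `Graph` (whose `other` pairs φ′-legs and
A′-legs only): which averaging vertices of the graph are multiplied in pairs (p. 415 (1.18): *"−a_k[…][…], or −½a_k if they are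
equal"*), the unpaired ones being multiplied with the external field (1.12); supplied with the graph. [cite: Balaban1983Higgs3, (1.18) p.415] -/
abbrev OutPairing : Type := Pairing (OLeg G.kind)

variable {G SF VF OF}
variable {IS IV IO : Type*} [Fintype IS] [Fintype IV] [Fintype IO]

/-- The COORDINATE basis of scalar-leg fields: `δ_{(x,a)}` = the unit vector `e_a` of the internal space at the site `x`, `0` elsewhere
(index type `IS = X × Fin N`). [cite: Balaban1983Higgs3, p.414] -/
def basisS {X : Type*} [DecidableEq X] {N : ℕ} (p : X × Fin N) : X → Fin N → ℝ :=
  fun x a => if x = p.1 ∧ a = p.2 then 1 else 0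

/-- The coordinate basis of bond fields: `δ_b` (index type `IV = Bd`). [cite: Balaban1983Higgs3, p.414] -/
def basisV {Bd : Type*} [DecidableEq Bd] (b : Bd) : Bd → ℝ := fun b' => if b' = b then 1 else 0

/-- The coordinate basis of output co-vectors: `e_a` (index type `IO = Fin N`). [cite: Balaban1983Higgs3, (1.18) p.415] -/
def basisO {N : ℕ} (a : Fin N) : Fin N → ℝ := fun c => if c = a then 1 else 0

/-- The VERTEX FACTOR at an index assignment (`α`: φ′-legs ↦ scalar indices, `β`: A′-legs ↦ vector indices, `ο`: output slots ↦
output indices): every vertex rule evaluated on the basis elements of its legs' indices. [cite: Balaban1983Higgs3, p.414] -/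
def vertexFactor (V : Rules G SF VF OF) (bS : IS → SF) (bV : IV → VF) (bO : IO → OF) (α : SLeg G.kind → IS)
    (β : VLeg G.kind → IV) (ο : OLeg G.kind → IO) : ℝ :=
  ∏ i : Fin G.nV, V i (fun j => bS (α ⟨i, j⟩)) (fun j => bV (β ⟨i, j⟩)) (fun j => bO (ο ⟨i, j⟩))

/-- The SCALAR LINE FACTOR: *"each pair is replaced by the corresponding propagator"* — the product over the internal scalar lines
of the entry of the line's propagator between the indices of its two legs (in coordinates `Ks l (x,a) (x′,b) = ⟪e_a, G(x,x′)e_b⟫`;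
one kernel per line). [cite: Balaban1983Higgs3, p.414] -/
def sLineFactor (Ks : SLine G → IS → IS → ℝ) (α : SLeg G.kind → IS) : ℝ :=
  ∏ l : SLine G, Ks l (α l.1) (α ((sPairing G).mate l.1))

/-- The VECTOR LINE FACTOR: the product over the internal vector lines of the line's covariance between its two legs' indices.
[cite: Balaban1983Higgs3, p.414] -/
def vLineFactor (Kv : VLine G → IV → IV → ℝ) (β : VLeg G.kind → IV) : ℝ :=
  ∏ l : VLine G, Kv l (β l.1) (β ((vPairing G).mate l.1))

/-- The OUTPUT PAIR FACTOR of (1.18): the product over the paired outputs of the pair's kernel between the two output indices (in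
coordinates `−a_k·δ_{ab}` at the common point). [cite: Balaban1983Higgs3, (1.18) p.415] -/
def oLineFactor (Po : OutPairing G) (Ko : Po.Line oRank → IO → IO → ℝ) (ο : OLeg G.kind → IO) : ℝ :=
  ∏ l : Po.Line oRank, Ko l (ο l.1) (ο (Po.mate l.1))

/-- PRODUCT external scalar fields in coordinates (one field per external φ′-leg) as a joint component function:
`γ ↦ Π_ℓ (φ_ℓ(x_ℓ))_{a_ℓ}`. [cite: Balaban1983Higgs3, p.419] -/
def prodExtS {X : Type*} {N : ℕ} (φ : ExtSLeg G → X → Fin N → ℝ) : (ExtSLeg G → X × Fin N) → ℝ :=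
  fun γ => ∏ ℓ : ExtSLeg G, φ ℓ (γ ℓ).1 (γ ℓ).2

/-- PRODUCT external vector fields in coordinates (one bond field per external A′-leg). [cite: Balaban1983Higgs3, p.419] -/
def prodExtV {Bd : Type*} (A : ExtVLeg G → Bd → ℝ) : (ExtVLeg G → Bd) → ℝ :=
  fun ζ => ∏ ℓ : ExtVLeg G, A ℓ (ζ ℓ)

/-- **E(G, Φ_ext, A_ext) — the expression corresponding to the graph `G`** (p. 420), in index form: the sum over the index
assignments `α` (φ′-legs ↦ scalar indices `IS`, in coordinates (site, internal index)), `β` (A′-legs ↦ vector indices `IV`, in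
coordinates bonds) and `ο` (output slots of the averaging vertices ↦ output indices `IO`, in coordinates the internal index) of the
vertex factor, the external-field components at the external legs' and unpaired outputs' indices (jointly: *"functions of many
variables instead of a product"*, p. 419; `Ψ` = the components of the external fields (1.12) paired with the unpaired averaging
vertices, with the coefficient of (1.18)) and the line factors (*"each pair is replaced by the corresponding propagator"*, p. 414;
`Ko` = the (1.18) pairing kernels of the paired outputs). [cite: Balaban1983Higgs3, p.420] [cite: Balaban1983Higgs3, p.414]
[cite: Balaban1983Higgs3, (1.18) p.415] -/
def amp (V : Rules G SF VF OF) (bS : IS → SF) (bV : IV → VF) (bO : IO → OF) (Po : OutPairing G)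
    (Ks : SLine G → IS → IS → ℝ) (Kv : VLine G → IV → IV → ℝ) (Ko : Po.Line oRank → IO → IO → ℝ)
    (Φ : (ExtSLeg G → IS) → ℝ) (A : (ExtVLeg G → IV) → ℝ) (Ψ : (Po.Ext → IO) → ℝ) : ℝ :=
  ∑ α : SLeg G.kind → IS, ∑ β : VLeg G.kind → IV, ∑ ο : OLeg G.kind → IO,
    vertexFactor V bS bV bO α β ο * (Φ (fun ℓ => α ℓ.1) * A (fun ℓ => β ℓ.1) * Ψ (fun ℓ => ο ℓ.1)) *
      (sLineFactor Ks α * vLineFactor Kv β * oLineFactor Po Ko ο)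

/-! ## §5 (2.7) and the localization sum on the evaluator -/

/-- kernel: a triple sum of terms each of which is a sum over a fourth index is the quadruple sum with the fourth index outermost.
[folklore] -/
private theorem sum3_of_sum {ι κ μ τ : Type*} [Fintype ι] [Fintype κ] [Fintype μ] [Fintype τ] (f : ι → κ → μ → ℝ)
    (g : τ → ι → κ → μ → ℝ) (h : ∀ a b c, f a b c = ∑ t, g t a b c) :
    ∑ a, ∑ b, ∑ c, f a b c = ∑ t, ∑ a, ∑ b, ∑ c, g t a b c := by
  simp only [h]
  have h1 : ∀ a b, ∑ c, ∑ t, g t a b c = ∑ t, ∑ c, g t a b c := fun a b => sum_comm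
  simp only [h1]
  have h2 : ∀ a, ∑ b, ∑ t, ∑ c, g t a b c = ∑ t, ∑ b, ∑ c, g t a b c := fun a => sum_comm
  simp only [h2]
  exact sum_comm

/-- **(2.7) pp. 424–425 ON THE EVALUATOR, scalar lines**: if the propagator of every scalar line is decomposed as a finite sum of
pieces, `Ks l = Σ_{t∈T} K l t` ((2.6): the scale pieces G^η_{(j)}, `T = Fin k`), then *"We can write E(G′) as a sum Σ_j E(G′(j))"* over
the assignments `j : lines → T` of a piece to every line: `amp … Ks … = Σ_j amp … (l ↦ K l (j l)) …`.
[cite: Balaban1983Higgs3, (2.7) p.425] [cite: Balaban1983Higgs3, (2.6) p.424] -/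
theorem amp_sLines_sum {T : Type*} [Fintype T] (V : Rules G SF VF OF) (bS : IS → SF) (bV : IV → VF) (bO : IO → OF)
    (Po : OutPairing G) (K : SLine G → T → IS → IS → ℝ) (Kv : VLine G → IV → IV → ℝ) (Ko : Po.Line oRank → IO → IO → ℝ)
    (Φ : (ExtSLeg G → IS) → ℝ) (A : (ExtVLeg G → IV) → ℝ) (Ψ : (Po.Ext → IO) → ℝ) :
    amp V bS bV bO Po (fun l p q => ∑ t, K l t p q) Kv Ko Φ A Ψ =
      ∑ j : SLine G → T, amp V bS bV bO Po (fun l => K l (j l)) Kv Ko Φ A Ψ := by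
  unfold amp
  refine sum3_of_sum _ _ fun α β ο => ?_
  have hs : sLineFactor (fun l p q => ∑ t, K l t p q) α = ∑ j : SLine G → T, sLineFactor (fun l => K l (j l)) α := by
    unfold sLineFactor
    exact Fintype.prod_sum fun l t => K l t (α l.1) (α ((sPairing G).mate l.1))
  rw [hs, sum_mul, sum_mul, mul_sum]

/-- **(2.7) ON THE EVALUATOR, vector lines**: *"and the similar equality for the vector field propagator"* — the same decomposition
over the vector lines. [cite: Balaban1983Higgs3, (2.7) p.425] -/
theorem amp_vLines_sum {T : Type*} [Fintype T] (V : Rules G SF VF OF) (bS : IS → SF) (bV : IV → VF) (bO : IO → OF)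
    (Po : OutPairing G) (Ks : SLine G → IS → IS → ℝ) (K : VLine G → T → IV → IV → ℝ) (Ko : Po.Line oRank → IO → IO → ℝ)
    (Φ : (ExtSLeg G → IS) → ℝ) (A : (ExtVLeg G → IV) → ℝ) (Ψ : (Po.Ext → IO) → ℝ) :
    amp V bS bV bO Po Ks (fun l p q => ∑ t, K l t p q) Ko Φ A Ψ =
      ∑ j : VLine G → T, amp V bS bV bO Po Ks (fun l => K l (j l)) Ko Φ A Ψ := by
  unfold amp
  refine sum3_of_sum _ _ fun α β ο => ?_
  have hv : vLineFactor (fun l p q => ∑ t, K l t p q) β = ∑ j : VLine G → T, vLineFactor (fun l => K l (j l)) β := by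
    unfold vLineFactor
    exact Fintype.prod_sum fun l t => K l t (β l.1) (β ((vPairing G).mate l.1))
  rw [hv, mul_sum, sum_mul, mul_sum]

/-- **p. 420 *"with each expression there is connected some localization {□(v)}_{v∈G}"* ON THE EVALUATOR**: if every vertex rule is
the sum of its LOCALIZED rules, `V i = Σ_{c∈C i} W i c` (the vertex's position sum split by a partition of unity — unit cubes, smooth
partition members, points: `B3LocalizedExpression420.sum_locSum_eq`), then the expression of the graph is the sum over all assignments
`c : v ↦ □(v)` of the localized expressions E(G, {□(v)}, Φ, A) = `amp (i ↦ W i (c i)) …`.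
[cite: Balaban1983Higgs3, p.420] -/
theorem amp_rules_sum {C : Fin G.nV → Type*} [∀ i, Fintype (C i)]
    (W : (i : Fin G.nV) → C i → (Fin (G.kind i).scalarLegs → SF) → (Fin (G.kind i).vectorLegs → VF) →
      (Fin (outSlots (G.kind i)) → OF) → ℝ)
    (bS : IS → SF) (bV : IV → VF) (bO : IO → OF) (Po : OutPairing G) (Ks : SLine G → IS → IS → ℝ)
    (Kv : VLine G → IV → IV → ℝ) (Ko : Po.Line oRank → IO → IO → ℝ) (Φ : (ExtSLeg G → IS) → ℝ) (A : (ExtVLeg G → IV) → ℝ)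
    (Ψ : (Po.Ext → IO) → ℝ) :
    amp (fun i fs fv fo => ∑ c, W i c fs fv fo) bS bV bO Po Ks Kv Ko Φ A Ψ =
      ∑ c : (i : Fin G.nV) → C i, amp (fun i => W i (c i)) bS bV bO Po Ks Kv Ko Φ A Ψ := by
  unfold amp
  refine sum3_of_sum _ _ fun α β ο => ?_
  have hv : vertexFactor (fun i fs fv fo => ∑ c, W i c fs fv fo) bS bV bO α β ο =
      ∑ c : (i : Fin G.nV) → C i, vertexFactor (fun i => W i (c i)) bS bV bO α β ο := by
    unfold vertexFactor
    exact Fintype.prod_sum fun i c => W i c (fun j => bS (α ⟨i, j⟩)) (fun j => bV (β ⟨i, j⟩)) (fun j => bO (ο ⟨i, j⟩))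
  rw [hv, sum_mul, sum_mul]

/-- E(G, ·, A_ext) is ADDITIVE in the external scalar field (the expression is linear in Φ_ext). [cite: Balaban1983Higgs3, p.419] -/
theorem amp_add_extS (V : Rules G SF VF OF) (bS : IS → SF) (bV : IV → VF) (bO : IO → OF) (Po : OutPairing G)
    (Ks : SLine G → IS → IS → ℝ) (Kv : VLine G → IV → IV → ℝ) (Ko : Po.Line oRank → IO → IO → ℝ)
    (Φ Φ' : (ExtSLeg G → IS) → ℝ) (A : (ExtVLeg G → IV) → ℝ) (Ψ : (Po.Ext → IO) → ℝ) :
    amp V bS bV bO Po Ks Kv Ko (fun γ => Φ γ + Φ' γ) A Ψ =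
      amp V bS bV bO Po Ks Kv Ko Φ A Ψ + amp V bS bV bO Po Ks Kv Ko Φ' A Ψ := by
  unfold amp
  rw [← sum_add_distrib]
  refine sum_congr rfl fun α _ => ?_
  rw [← sum_add_distrib]
  refine sum_congr rfl fun β _ => ?_
  rw [← sum_add_distrib]
  refine sum_congr rfl fun ο _ => ?_
  ring

/-- E(G, ·, A_ext) is HOMOGENEOUS in the external scalar field. [cite: Balaban1983Higgs3, p.419] -/
theorem amp_smul_extS (V : Rules G SF VF OF) (bS : IS → SF) (bV : IV → VF) (bO : IO → OF) (Po : OutPairing G)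
    (Ks : SLine G → IS → IS → ℝ) (Kv : VLine G → IV → IV → ℝ) (Ko : Po.Line oRank → IO → IO → ℝ)
    (r : ℝ) (Φ : (ExtSLeg G → IS) → ℝ) (A : (ExtVLeg G → IV) → ℝ) (Ψ : (Po.Ext → IO) → ℝ) :
    amp V bS bV bO Po Ks Kv Ko (fun γ => r * Φ γ) A Ψ = r * amp V bS bV bO Po Ks Kv Ko Φ A Ψ := by
  unfold amp
  rw [mul_sum]
  refine sum_congr rfl fun α _ => ?_
  rw [mul_sum]
  refine sum_congr rfl fun β _ => ?_
  rw [mul_sum]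
  refine sum_congr rfl fun ο _ => ?_
  ring

/-- **The coordinate instance**: E(G, Φ_ext, A_ext) for vertex rules on coordinate fields (`X → Fin N → ℝ`, `Bd → ℝ`, output
co-vectors `Fin N → ℝ`), indices (site, internal index), bonds and internal indices, coordinate bases `basisS`/`basisV`/`basisO`.
[cite: Balaban1983Higgs3, p.420] -/
def ampCoord {X Bd : Type*} [Fintype X] [DecidableEq X] [Fintype Bd] [DecidableEq Bd] {N : ℕ}
    (V : Rules G (X → Fin N → ℝ) (Bd → ℝ) (Fin N → ℝ)) (Po : OutPairing G) (Ks : SLine G → X × Fin N → X × Fin N → ℝ)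
    (Kv : VLine G → Bd → Bd → ℝ) (Ko : Po.Line oRank → Fin N → Fin N → ℝ) (Φ : (ExtSLeg G → X × Fin N) → ℝ)
    (A : (ExtVLeg G → Bd) → ℝ) (Ψ : (Po.Ext → Fin N) → ℝ) : ℝ :=
  amp V basisS basisV basisO Po Ks Kv Ko Φ A Ψ

end Amplitude

end Literature.MathematicalPhysics.QuantumFieldTheory.Balaban1983to89.B3GraphAmplitude
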